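import Summits.QuantumFields.YangMills.Theorems.F4SubCurvatureDoorShortRootRigidityPlanarFrameGluing
import Summits.QuantumFields.YangMills.Theorems.F4SubCurvatureDoorShortRootRigidityFlatDoubleEdge
import Summits.QuantumFields.YangMills.Theorems.F4SubCurvatureDoorShortRootRigidityPlanarConeSupport
import Summits.QuantumFields.YangMills.Theorems.F4SubCurvatureDoorRationalToGeneralPringsheimCore
import Mathlib
import HarnessLib

/-!
# LINE g21-C «aperture bootstrap» (crux ⟨stmt-QuantumFields-23035⟩ `ShortRootRigidity`) — R-S3d PRELIMINARIES (part 1 of 2) for the registered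
# stub `:137` `stub_planarApertureStep` (file `…PlanarApertureStep`): `p`-marginal, pinning with an energy cap, edge geometry

Owner STUB-PLAN `Cruxes/ShortRootRigidity/Lines/aperture_bootstrap_stubplans.md` (planner ym-idea-3 g21, sha16 a045f2eb0c54f2ce), H4–H10, on top of
H1–H3 (`…PlanarFrameGluing`, this seat).  Fix `0 < τ < 1`, `t ≥ 1`, the shift `ε = 1`.

* H4 the shifted frame functions `G₀(z) = F₀(z + (1,0))`, `Gp(z) = F₊(z + (1,0))` are bounded by `M := ∫ e^{−E/2} dμ` on `T₀(τ)`, `T₊(τ)`;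
* H5 edge geometry at `z⋆ = (t, iτt)`, radius `r = τt/3` (max norm): the functionals `l₀ = (iτ, −1)`, `l₊ = (√3/2 + iτ/2, −1/2 + iτ√3/2)` are
  ℂ-independent (`det = (√3/2)(1 − τ²)`), and `{Im l₀(z − z⋆) > 0} ∩ B(z⋆, r) ⊂ T₀`, `{Im l₊(z − z⋆) > 0} ∩ B(z⋆, r) ⊂ T₊`;
* H6 `FlatDoubleEdge` (hypothesis, BY NAME — landed as `:128`) applied to the glued `f` gives `g` holomorphic on `B(z⋆, δ₁r)`, `‖g‖ ≤ M`;
* H7–H8 on the line `ζ = t` the function `Φ` (strip `|Im β| < τt` ∪ two discs of radius `ρ = δ₁τt/3` at `±iτt`) is holomorphic and bounded by `M`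
  on the disc `|β| < R`, `R = (τ + δ″)t`, `δ″ = δ₁²τ/72`, with real trace `s ↦ ∫ e^{−(t+1)E} cos(sp) dμ`;
* H9 the one-dimensional Pringsheim step `…PringsheimCore.cosh_integral_le_of_holomorphic` (this seat, p719524) on the `p`-marginal of
  `e^{−(t+1)E}μ` gives `∫ e^{−(t+1)E} cosh((τ + δ″/2)t·p) dμ ≤ M` for every `t ≥ 1`;
* H10 pinning with an energy cap turns this into `HasAperture μ (τ + δ″/2)`.

HONEST LABEL: a registered stub of an OPEN line; with `:128 ✓`, `:132 ✓`, this `:137` and w3's `:141`, the line's remaining open stub is the shared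
`stub_oddModeRigidity`; (C)'s support form becomes a theorem, but ⟨23035⟩, ⟨23125⟩, R2d and the Yang–Mills mass gap remain OPEN here; no summit
is proved by a line.  Lead seat `ym-line-sfw-p2` g75 (cell ym-idea-1, free hands).
-/

set_option autoImplicit false

noncomputable section

open MeasureTheory Filter Topology Set Metric Complex
open scoped BigOperators ENNReal NNReal

namespace Summit.QuantumFields.YangMills.Theorems.F4SubCurvatureDoorPlanarApertureStepPrelims

open Summit.QuantumFields.YangMills.Theorems.F4SubCurvatureDoorSliceDensityRegistered (E2)
open Summit.QuantumFields.YangMills.Theorems.F4SubCurvatureDoorSliceInClassRegistered (InPlanarClass)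
open Summit.QuantumFields.YangMills.Cruxes.ShortRootRigidity.AngularType (mk2)
open Summit.QuantumFields.YangMills.Theorems.F4SubCurvatureDoorPlanarFrameGluing
open Summit.QuantumFields.YangMills.Theorems.F4SubCurvatureDoorFlatDoubleEdgeRegistered (FlatDoubleEdge)
open Summit.QuantumFields.YangMills.Theorems.F4SubCurvatureDoorPlanarInitialApertureRegistered (IsPlanarLF HasAperture)
open Summit.QuantumFields.YangMills.Theorems.F4SubCurvatureDoorPlanarConeSupportRegistered (PlanarApertureStep)
open Summit.QuantumFields.YangMills.Theorems.F4SubCurvatureDoorPringsheimCore (cosh_integral_le_of_holomorphic)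

/-! ## A. The `p`-marginal of `e^{−sE}μ` -/

section Marginal

variable (μ : Measure (ℝ × ℝ)) (s : ℝ)

/-- The Laplace weight as an `ℝ≥0` density. -/
def wt2 (z : ℝ × ℝ) : ℝ≥0 := Real.toNNReal (Real.exp (-(s * z.1)))

/-- The weight is measurable. -/
theorem measurable_wt2 : Measurable (wt2 s) := by unfold wt2; fun_prop

/-- The weight, coerced back. -/
theorem coe_wt2 (z : ℝ × ℝ) : ((wt2 s z : ℝ≥0) : ℝ) = Real.exp (-(s * z.1)) := Real.coe_toNNReal _ (Real.exp_pos _).le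

/-- The weighted `p`-marginal. -/
def marg2 : Measure ℝ := (μ.withDensity fun z => (wt2 s z : ℝ≥0∞)).map Prod.snd

/-- Integrals against the marginal (continuous integrands). -/
theorem integral_marg2 {φ : ℝ → ℝ} (hφ : Continuous φ) :
    ∫ q, φ q ∂(marg2 μ s) = ∫ z : ℝ × ℝ, Real.exp (-(s * z.1)) * φ z.2 ∂μ := by
  rw [marg2, integral_map (by fun_prop) hφ.aestronglyMeasurable, integral_withDensity_eq_integral_smul (measurable_wt2 s)]
  refine integral_congr_ae (ae_of_all _ fun z => ?_)
  simp only [NNReal.smul_def, coe_wt2, smul_eq_mul]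

/-- Integrability against the marginal (continuous integrands). -/
theorem integrable_marg2_iff {φ : ℝ → ℝ} (hφ : Continuous φ) :
    Integrable φ (marg2 μ s) ↔ Integrable (fun z : ℝ × ℝ => Real.exp (-(s * z.1)) * φ z.2) μ := by
  rw [marg2, integrable_map_measure hφ.aestronglyMeasurable (by fun_prop),
    integrable_withDensity_iff_integrable_smul (measurable_wt2 s)]
  refine integrable_congr (ae_of_all _ fun z => ?_)
  simp only [Function.comp_apply, NNReal.smul_def, coe_wt2, smul_eq_mul]

/-- Finiteness of the marginal. -/
theorem isFiniteMeasure_marg2 (hint : Integrable (fun z : ℝ × ℝ => Real.exp (-(s * z.1))) μ) : IsFiniteMeasure (marg2 μ s) := by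
  have hfin : IsFiniteMeasure (μ.withDensity fun z => (wt2 s z : ℝ≥0∞)) := by
    refine isFiniteMeasure_withDensity ?_
    exact ((hasFiniteIntegral_iff_ofReal (ae_of_all _ fun z : ℝ × ℝ => (Real.exp_pos (-(s * z.1))).le)).1 hint.2).ne
  unfold marg2
  exact Measure.isFiniteMeasure_map _ _

end Marginal

/-! ## B. Pinning with an energy cap -/

section Pinning

variable {μ : Measure (ℝ × ℝ)}

/-- If `∫ e^{−(t+1)E} cosh(κtp) dμ ≤ C` for all `t ≥ 1`, the capped slab `{κ|p| − E ≥ η, E ≤ L}` is null. -/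
theorem measure_capped_slab_eq_zero {κ C η L : ℝ} (hη : 0 < η)
    (h : ∀ t : ℝ, 1 ≤ t → Integrable (fun z : ℝ × ℝ => Real.exp (-((t + 1) * z.1)) * Real.cosh (κ * t * z.2)) μ ∧
        ∫ z : ℝ × ℝ, Real.exp (-((t + 1) * z.1)) * Real.cosh (κ * t * z.2) ∂μ ≤ C) :
    μ {z : ℝ × ℝ | η ≤ κ * |z.2| - z.1 ∧ z.1 ≤ L} = 0 := by
  set S : Set (ℝ × ℝ) := {z | η ≤ κ * |z.2| - z.1 ∧ z.1 ≤ L} with hS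
  have hSm : MeasurableSet S := by
    rw [hS, Set.setOf_and]
    exact (measurableSet_le measurable_const ((measurable_snd.abs.const_mul κ).sub measurable_fst)).inter
      (measurableSet_le measurable_fst measurable_const)
  have hkey : ∀ t : ℝ, 1 ≤ t → μ S ≤ ENNReal.ofReal (2 * C * Real.exp (L - t * η)) := by
    intro t ht
    obtain ⟨hint, hle⟩ := h t ht
    -- on `S` the integrand is at least `e^{tη − L}/2`
    have hlow : ∀ z ∈ S, Real.exp (t * η - L) / 2 ≤ Real.exp (-((t + 1) * z.1)) * Real.cosh (κ * t * z.2) := by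
      intro z hz
      obtain ⟨hz1, hz2⟩ := hz
      have h1 : Real.exp (|κ * t * z.2|) ≤ 2 * Real.cosh (κ * t * z.2) := by
        rw [Real.cosh_eq]; rcases le_or_gt 0 (κ * t * z.2) with hx | hx
        · rw [abs_of_nonneg hx]; linarith [Real.exp_pos (-(κ * t * z.2))]
        · rw [abs_of_neg hx]; linarith [Real.exp_pos (κ * t * z.2)]
      have ht0 : (0 : ℝ) ≤ t := by linarith
      have h2a : κ * t * |z.2| ≤ |κ * t * z.2| := by
        rw [abs_mul, abs_mul, abs_of_nonneg ht0]
        have : κ * t * |z.2| ≤ |κ| * t * |z.2| :=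
          mul_le_mul_of_nonneg_right (mul_le_mul_of_nonneg_right (le_abs_self κ) ht0) (abs_nonneg _)
        exact this
      have h2b : t * η ≤ κ * t * |z.2| - t * z.1 := by nlinarith [hz1, ht0]
      have h2 : t * η - L ≤ -((t + 1) * z.1) + |κ * t * z.2| := by nlinarith [hz2, h2a, h2b]
      calc Real.exp (t * η - L) / 2 ≤ Real.exp (-((t + 1) * z.1) + |κ * t * z.2|) / 2 := by
            gcongr
        _ = Real.exp (-((t + 1) * z.1)) * (Real.exp (|κ * t * z.2|) / 2) := by rw [Real.exp_add]; ring
        _ ≤ Real.exp (-((t + 1) * z.1)) * Real.cosh (κ * t * z.2) :=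
            mul_le_mul_of_nonneg_left (by linarith) (Real.exp_pos _).le
    have h1 : ENNReal.ofReal (Real.exp (t * η - L) / 2) * μ S
        ≤ ∫⁻ z, ENNReal.ofReal (Real.exp (-((t + 1) * z.1)) * Real.cosh (κ * t * z.2)) ∂μ := by
      calc ENNReal.ofReal (Real.exp (t * η - L) / 2) * μ S = ∫⁻ _ in S, ENNReal.ofReal (Real.exp (t * η - L) / 2) ∂μ := by
            rw [setLIntegral_const]
        _ ≤ ∫⁻ z in S, ENNReal.ofReal (Real.exp (-((t + 1) * z.1)) * Real.cosh (κ * t * z.2)) ∂μ :=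
            setLIntegral_mono' hSm fun z hz => ENNReal.ofReal_le_ofReal (hlow z hz)
        _ ≤ _ := setLIntegral_le_lintegral _ _
    have h2 : ∫⁻ z, ENNReal.ofReal (Real.exp (-((t + 1) * z.1)) * Real.cosh (κ * t * z.2)) ∂μ ≤ ENNReal.ofReal C := by
      rw [← ofReal_integral_eq_lintegral_ofReal hint (ae_of_all _ fun z => by positivity)]
      exact ENNReal.ofReal_le_ofReal hle
    have hpos : 0 < Real.exp (t * η - L) / 2 := by positivity
    calc μ S = (ENNReal.ofReal (Real.exp (t * η - L) / 2))⁻¹ * (ENNReal.ofReal (Real.exp (t * η - L) / 2) * μ S) := by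
          rw [← mul_assoc, ENNReal.inv_mul_cancel (by simpa using hpos) ENNReal.ofReal_ne_top, one_mul]
      _ ≤ (ENNReal.ofReal (Real.exp (t * η - L) / 2))⁻¹ * ENNReal.ofReal C := by gcongr; exact h1.trans h2
      _ = ENNReal.ofReal (2 * C * Real.exp (L - t * η)) := by
          rw [← ENNReal.ofReal_inv_of_pos hpos, ← ENNReal.ofReal_mul (by positivity)]
          congr 1
          rw [show L - t * η = -(t * η - L) by ring, Real.exp_neg]
          field_simp
  have htend : Tendsto (fun t : ℝ => ENNReal.ofReal (2 * C * Real.exp (L - t * η))) atTop (𝓝 0) := by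
    rw [← ENNReal.ofReal_zero]
    refine ENNReal.tendsto_ofReal ?_
    have h1 : Tendsto (fun t : ℝ => Real.exp (L - t * η)) atTop (𝓝 0) := by
      have h0 : Tendsto (fun t : ℝ => -(t * η) + L) atTop atBot :=
        tendsto_atBot_add_const_right _ L (tendsto_neg_atTop_atBot.comp (tendsto_id.atTop_mul_const hη))
      have : Tendsto (fun t : ℝ => L - t * η) atTop atBot := by
        refine h0.congr fun t => ?_
        ring
      exact Real.tendsto_exp_atBot.comp this
    simpa using h1.const_mul (2 * C)
  refine le_antisymm (ge_of_tendsto htend ?_) bot_le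
  rw [eventually_atTop]
  exact ⟨1, fun t ht => hkey t ht⟩

/-- **Pinning.**  A `t`-uniform bound on `∫ e^{−(t+1)E} cosh(κtp) dμ` for `t ≥ 1` forces `HasAperture μ κ`. -/
theorem hasAperture_of_cosh_bound {κ C : ℝ}
    (h : ∀ t : ℝ, 1 ≤ t → Integrable (fun z : ℝ × ℝ => Real.exp (-((t + 1) * z.1)) * Real.cosh (κ * t * z.2)) μ ∧
        ∫ z : ℝ × ℝ, Real.exp (-((t + 1) * z.1)) * Real.cosh (κ * t * z.2) ∂μ ≤ C) :
    HasAperture μ κ := by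
  have hslab : ∀ n : ℕ, μ {z : ℝ × ℝ | (1 : ℝ) / (n + 1) ≤ κ * |z.2| - z.1 ∧ z.1 ≤ (n : ℝ) + 1} = 0 := fun n =>
    measure_capped_slab_eq_zero (by positivity) h
  have hcov : {z : ℝ × ℝ | z.1 < κ * |z.2|} ⊆ ⋃ n : ℕ, {z : ℝ × ℝ | (1 : ℝ) / (n + 1) ≤ κ * |z.2| - z.1 ∧ z.1 ≤ (n : ℝ) + 1} := by
    intro z hz
    simp only [mem_setOf_eq] at hz
    obtain ⟨n₁, hn₁⟩ := exists_nat_one_div_lt (sub_pos.2 hz)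
    obtain ⟨n₂, hn₂⟩ := exists_nat_ge z.1
    refine mem_iUnion.2 ⟨max n₁ n₂, ?_, ?_⟩
    · have : (1 : ℝ) / ((max n₁ n₂ : ℕ) + 1) ≤ 1 / (n₁ + 1) := by
        gcongr; exact_mod_cast le_max_left n₁ n₂
      linarith
    · have : (n₂ : ℝ) ≤ ((max n₁ n₂ : ℕ) : ℝ) := by exact_mod_cast le_max_right n₁ n₂
      linarith
  exact measure_mono_null hcov (measure_iUnion_null hslab)

end Pinning

/-! ## C. Edge geometry at `z⋆ = (t, iτt)` -/

section Geometry

/-- `L₊` as a continuous ℂ-linear map. -/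
def LplusCLM : (ℂ × ℂ) →L[ℂ] (ℂ × ℂ) :=
  (((1 / 2 : ℂ) • ContinuousLinearMap.fst ℂ ℂ ℂ) + (((Real.sqrt 3 / 2 : ℝ) : ℂ) • ContinuousLinearMap.snd ℂ ℂ ℂ)).prod
    ((-(((Real.sqrt 3 / 2 : ℝ) : ℂ))) • ContinuousLinearMap.fst ℂ ℂ ℂ + ((1 / 2 : ℂ) • ContinuousLinearMap.snd ℂ ℂ ℂ))

/-- `LplusCLM = L₊`. -/
theorem LplusCLM_apply (q : ℂ × ℂ) : LplusCLM q = Lplus q := by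
  ext <;> simp [LplusCLM, Lplus]

/-- The frame-0 conormal at the edge: `l₀(ζ, β) = iτζ − β`. -/
def l0 (τ : ℝ) : (ℂ × ℂ) →L[ℂ] ℂ := (I * (τ : ℂ)) • ContinuousLinearMap.fst ℂ ℂ ℂ - ContinuousLinearMap.snd ℂ ℂ ℂ

/-- The frame-`+60°` conormal at the edge: `l₊ = l₀ ∘ L₊`. -/
def lp (τ : ℝ) : (ℂ × ℂ) →L[ℂ] ℂ := (l0 τ).comp LplusCLM

/-- `l₀` in coordinates. -/
theorem l0_apply (τ : ℝ) (q : ℂ × ℂ) : l0 τ q = I * (τ : ℂ) * q.1 - q.2 := by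
  simp [l0]

/-- `Im l₀(ζ, β) = τ Re ζ − Im β`. -/
theorem im_l0 (τ : ℝ) (q : ℂ × ℂ) : (l0 τ q).im = τ * q.1.re - q.2.im := by
  rw [l0_apply]; simp [Complex.mul_im, Complex.mul_re]

/-- `l₊` in coordinates. -/
theorem lp_apply (τ : ℝ) (q : ℂ × ℂ) : lp τ q = I * (τ : ℂ) * (Lplus q).1 - (Lplus q).2 := by
  simp [lp, ContinuousLinearMap.comp_apply, LplusCLM_apply, l0_apply]

/-- `Im l₊(z) = τ Re(z·u₊) − Im(z·u₊^⊥)`. -/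
theorem im_lp (τ : ℝ) (q : ℂ × ℂ) : (lp τ q).im = τ * (Lplus q).1.re - (Lplus q).2.im := by
  rw [lp_apply]; simp [Complex.mul_im, Complex.mul_re]

/-- The two conormals are ℂ-independent for `τ² ≠ 1` (`det = (√3/2)(1 − τ²)`). -/
theorem linearIndependent_l0_lp {τ : ℝ} (hτ0 : 0 < τ) (hτ1 : τ < 1) : LinearIndependent ℂ ![l0 τ, lp τ] := by
  rw [LinearIndependent.pair_iff]
  intro s t hst
  have h1 := congrArg (fun L : (ℂ × ℂ) →L[ℂ] ℂ => L ((1 : ℂ), (0 : ℂ))) hst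
  have h2 := congrArg (fun L : (ℂ × ℂ) →L[ℂ] ℂ => L ((0 : ℂ), (1 : ℂ))) hst
  change s * l0 τ ((1 : ℂ), (0 : ℂ)) + t * lp τ ((1 : ℂ), (0 : ℂ)) = 0 at h1
  change s * l0 τ ((0 : ℂ), (1 : ℂ)) + t * lp τ ((0 : ℂ), (1 : ℂ)) = 0 at h2
  simp only [l0_apply, lp_apply, Lplus] at h1 h2
  -- `h1 : s (iτ) + t (√3/2 + iτ/2) = 0`, `h2 : −s + t (−1/2 + iτ√3/2) = 0`
  have hs3 : ((Real.sqrt 3 : ℝ) : ℂ) ^ 2 = 3 := by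
    rw [← Complex.ofReal_pow, Real.sq_sqrt (by norm_num)]; norm_num
  have key : t * ((((Real.sqrt 3 / 2 : ℝ)) : ℂ) * (1 - (τ : ℂ) ^ 2)) = 0 := by
    have e1 := h1
    have e2 := h2
    push_cast at e1 e2 ⊢
    linear_combination e1 + (I * (τ : ℂ)) * e2 - (t * ((Real.sqrt 3 : ℝ) : ℂ) / 2 * (τ : ℂ) ^ 2) * Complex.I_sq
  have hne : (((Real.sqrt 3 / 2 : ℝ)) : ℂ) * (1 - (τ : ℂ) ^ 2) ≠ 0 := by
    refine mul_ne_zero ?_ ?_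
    · exact_mod_cast (by positivity : Real.sqrt 3 / 2 ≠ 0)
    · have : (1 : ℝ) - τ ^ 2 ≠ 0 := by nlinarith
      exact_mod_cast this
  have ht : t = 0 := by
    rcases mul_eq_zero.1 key with h | h
    · exact h
    · exact absurd h hne
  refine ⟨?_, ht⟩
  rw [ht] at h2
  push_cast at h2
  linear_combination -h2

/-- The edge point `z⋆ = (t, iτt)`. -/
def zstar (τ t : ℝ) : ℂ × ℂ := ((t : ℂ), I * ((τ * t : ℝ) : ℂ))

/-- `L₊` is additive (it is linear). -/
theorem Lplus_add (p q : ℂ × ℂ) : Lplus (p + q) = Lplus p + Lplus q := by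
  rw [← LplusCLM_apply, ← LplusCLM_apply, ← LplusCLM_apply, map_add]

/-- `L₊ z⋆`: time part `t/2`, imaginary space part `τt/2`. -/
theorem Lplus_zstar (τ t : ℝ) : (Lplus (zstar τ t)).1.re = t / 2 ∧ (Lplus (zstar τ t)).2.im = τ * t / 2 := by
  constructor
  · rw [zstar, Lplus_fst_re]; simp
  · rw [zstar, Lplus_snd_im]; simp

/-- H5 (ii), frame 0: near the edge, `Im l₀(z − z⋆) > 0` puts `z` in `T₀`. -/
theorem mem_tube_of_im_l0_pos {τ t : ℝ} (hτ : 0 < τ) (ht : 1 ≤ t) {z : ℂ × ℂ} (hz : ‖z - zstar τ t‖ < τ * t / 3)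
    (h : 0 < (l0 τ (z - zstar τ t)).im) : z ∈ tube τ := by
  rw [im_l0] at h
  have h1 : |(z - zstar τ t).1.re| ≤ ‖z - zstar τ t‖ := (Complex.abs_re_le_norm _).trans (norm_fst_le _)
  have h2 : |(z - zstar τ t).2.im| ≤ ‖z - zstar τ t‖ := (Complex.abs_im_le_norm _).trans (norm_snd_le _)
  have e1 : (z - zstar τ t).1.re = z.1.re - t := by simp [zstar]
  have e2 : (z - zstar τ t).2.im = z.2.im - τ * t := by simp [zstar]
  rw [e1] at h h1; rw [e2] at h h2
  rw [abs_le] at h1 h2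
  show |z.2.im| < τ * z.1.re
  have hτt : 0 < τ * t := by positivity
  rw [abs_of_pos (by nlinarith)]
  nlinarith

/-- H5 (ii), frame `+60°`: near the edge, `Im l₊(z − z⋆) > 0` puts `z` in `T₊`. -/
theorem mem_tubePlus_of_im_lp_pos {τ t : ℝ} (hτ : 0 < τ) (ht : 1 ≤ t) {z : ℂ × ℂ} (hz : ‖z - zstar τ t‖ < τ * t / 3)
    (h : 0 < (lp τ (z - zstar τ t)).im) : z ∈ tubePlus τ := by
  rw [im_lp] at h
  set w := z - zstar τ t with hw
  have hzw : z = zstar τ t + w := by rw [hw]; abel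
  have h1 : |w.1.im| ≤ ‖w‖ := (Complex.abs_im_le_norm _).trans (norm_fst_le _)
  have h2 : |w.2.im| ≤ ‖w‖ := (Complex.abs_im_le_norm _).trans (norm_snd_le _)
  have hL2 : (Lplus w).2.im = -(Real.sqrt 3 / 2 * w.1.im) + w.2.im / 2 := by
    have := Lplus_snd_im w.1 w.2; simpa using this
  obtain ⟨hs1, hs2⟩ := Lplus_zstar τ t
  have hs3 : Real.sqrt 3 < 2 := by
    rw [show (2 : ℝ) = Real.sqrt 4 by rw [show (4:ℝ) = 2^2 by norm_num, Real.sqrt_sq (by norm_num)]]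
    exact Real.sqrt_lt_sqrt (by norm_num) (by norm_num)
  have hs0 : 0 < Real.sqrt 3 := by positivity
  show |(Lplus z).2.im| < τ * (Lplus z).1.re
  rw [hzw, Lplus_add, Prod.snd_add, Prod.fst_add, Complex.add_im, Complex.add_re, hs1, hs2]
  rw [abs_le] at h1 h2
  have hτt : 0 < τ * t := by positivity
  have hb : |(Lplus w).2.im| < τ * t / 2 := by
    rw [hL2, abs_lt]; constructor <;> nlinarith
  rw [abs_lt] at hb
  rw [abs_of_pos (by linarith)]
  linarith

/-- H8: a point of the disc `|β| < (τ + δ₁²τ/72)t` with `Im β ≥ τt` lies in the small disc `|β − iτt| < δ₁τt/3`. -/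
theorem disc_fits {τ t δ₁ : ℝ} (hτ : 0 < τ) (hτ1 : τ < 1) (ht : 1 ≤ t) (hδ : 0 < δ₁) (hδ1 : δ₁ ≤ 1) {β : ℂ}
    (hβ : ‖β‖ < (τ + δ₁ ^ 2 * τ / 72) * t) (hIm : τ * t ≤ β.im) : ‖β - I * ((τ * t : ℝ) : ℂ)‖ < δ₁ * (τ * t / 3) := by
  have hρ : 0 < δ₁ * (τ * t / 3) := by positivity
  have hn0 : 0 ≤ ‖β‖ := norm_nonneg β
  refine lt_of_pow_lt_pow_left₀ 2 hρ.le ?_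
  have e1 : ‖β - I * ((τ * t : ℝ) : ℂ)‖ ^ 2 = β.re ^ 2 + (β.im - τ * t) ^ 2 := by
    rw [Complex.sq_norm, Complex.normSq_apply]; simp; ring
  have e2 : ‖β‖ ^ 2 = β.re ^ 2 + β.im ^ 2 := by
    rw [Complex.sq_norm, Complex.normSq_apply]; ring
  rw [e1]
  have h3 : β.re ^ 2 + β.im ^ 2 < ((τ + δ₁ ^ 2 * τ / 72) * t) ^ 2 := by
    rw [← e2]; exact pow_lt_pow_left₀ hβ hn0 two_ne_zero
  have hτt : 0 < τ * t := by positivity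
  have hA : (β.im - τ * t) ^ 2 ≤ β.im ^ 2 - (τ * t) ^ 2 := by nlinarith
  have hB : ((τ + δ₁ ^ 2 * τ / 72) * t) ^ 2 - (τ * t) ^ 2 = (δ₁ ^ 2 * τ ^ 2 / 36 + δ₁ ^ 4 * τ ^ 2 / 5184) * t ^ 2 := by
    ring
  have hC : δ₁ ^ 4 ≤ δ₁ ^ 2 := by nlinarith [sq_nonneg δ₁, mul_le_mul_of_nonneg_left hδ1 (sq_nonneg δ₁)]
  have hE : 0 < δ₁ ^ 2 * τ ^ 2 * t ^ 2 := by positivity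
  have hF : δ₁ ^ 4 * (τ ^ 2 * t ^ 2) ≤ δ₁ ^ 2 * (τ ^ 2 * t ^ 2) := mul_le_mul_of_nonneg_right hC (by positivity)
  have hD : (δ₁ ^ 2 * τ ^ 2 / 36 + δ₁ ^ 4 * τ ^ 2 / 5184) * t ^ 2 < (δ₁ * (τ * t / 3)) ^ 2 := by nlinarith
  nlinarith

end Geometry

end Summit.QuantumFields.YangMills.Theorems.F4SubCurvatureDoorPlanarApertureStepPrelims

end
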